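import Summits.BirchSwinnertonDyer.BirchSwinnertonDyer.Theorems.PrintX11aUpperNonSurjThreeEngineWithoutGZK
import Summits.BirchSwinnertonDyer.BirchSwinnertonDyer.Theorems.PrintX11aHardLocusRecordsDoor
import Summits.BirchSwinnertonDyer.BirchSwinnertonDyer.Theorems.PrintX11aMuCosetDoor
import Summits.BirchSwinnertonDyer.BirchSwinnertonDyer.Theorems.PrintX11aHardLocusRecordsFive3
import Summits.BirchSwinnertonDyer.BirchSwinnertonDyer.Theorems.PrintX11aHardLocusRecordsFive4
import HarnessLib

/-!
# Class X11a, NON-surjective leaf (`5S4`), the TAMAGAWA sub-locus @ 5 (`5 ∣ ∏ c_ℓ`): per-pair FLAG-FREE closures through the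
# NINE print-exact facts door, file 7 of 7 — `115320u1`, `184960ck1` (cell `bsd-print-x11a`, seat ty3 g9)

HONEST FRAMING (cells `b2b-bsdres` / `bsd-print-x11a`, verbatim): the goal is to DELETE the
COMBINATION-SHAPED residual classes of the Birch–Swinnerton-Dyer formula for ALL analytic-rank `≤ 1`
elliptic curves over `ℚ`; BSD is NOT proved by any of this; every theorem below is CONDITIONAL on its
displayed hypotheses; PER PAIR (E1 currency), never a class theorem; nothing here moves a PARTITION label.

WHAT. Referee A's census book (`pub/pub-bsdpct`, state R1049, 2026-08-28) also carries SEVEN non-surjective `5S4` X11a classes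
at tier LITERAL with register exactly {('JET@nonsurj',5), ('JET@p|N',5)} (Jetchev's Tamagawa theorem applied outside its printed
image/level hypotheses) and no open cell: 51840l1 51840m1 56180e1 64980g1 184960ck1 (split at `5`, `c₅ = 5`), 86640dt1 115320u1
(non-split, `5 ∣ c_q` elsewhere) — a flag-free by-name closure AT `p = 5` strikes both tokens (the desk's fold rule: literal → PROVED), where the Heegner-index road is unavailable (the index carries `∏ c_q`) but the cell holds a
two-engine `μ^an = 0` certificate (ty3 `RecordsLeafNonSurjMu*` / `…MuTables*`, §7–§8 of the cell doc) and a per-pair upper-half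
record (p3: `Theorems/PrintX11aMuCosetRecords2/3/5/7.lean`, `PrintX11aHardLocusRecordsFive3–4.lean`). Those records key the
Kato side to the THIRTEEN γ-keyed facts (`Kato2004.exists_multDivisibilityInputs_{nonsplit,split,fine}`, cell register counting
flag R-48) and were never offered. Since then the line seats landed the FLAG-FREE nine-print-exact-facts engine (x11a-p2 g3/g4, line-x11a-p3 g6:
`X11b.multDivisibilityAt_of_katoFacts_of_muAn_contra_of_mazur` + `X11b.missingUpperBoundAt_of_multDivisibilityAt_of_analyticRank_eq_zero_noGZK`,
facts Stein–Wuthrich 2013 Thm. 6.1 ×2, Kato 2004 Thm. 12.4, modularity `exists_isNewformOf`, Kato §17.13 V′/VI′/XI′ in the `_contra`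
(print-exact) form, Mazur 1978 Cor. 4.1, plus Greenberg–Stevens AT THE PAIR when `5` is split; packaged per pair as
`ClassX11a.missingUpperBoundAt_of_not_surj_of_hardCert_of_nineFacts`, p626443) whose analytic input is exactly the μ-certificate in
the allowable-root currency (`isMultPAdicLFunctionOf_one_iff`). This file RE-KEYS the records to that engine (the two `X11b`
steps inlined, so that no route file enters the import cone): per pair `mub5_t<label> : MissingUpperBoundAt W 5` and `bsdp5_t<label> : BSDp W 5` (`#Ш_an` a `5`-adic unit ⇒ lower half
free, p3's `bsdp_of_upper_of_unit_of_analyticRank_eq_zero` + GZK). The μ-certificate is rebuilt IN THE KERNEL from the displayed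
symbol values (`muAnZeroAt_of_cosetTable`, resp. the record file's own `muAn5_m<label>`; Mazur Cor. 4.1 only); minimality, the
Frobenius counts and (non-split pairs) the node-tangent quadratic are REUSED by import from p3's files — nothing restated.

DISPLAYED per pair (= the data of p3's record and ty3's μ-witness row, unchanged): `hW` (Cremona model), `hr` (`r_an = 0`),
`hnsj` (`ρ̄_{E,5}` not surjective: image `5S4`, Cremona/LMFDB + both ty3 engines), `ht` (`L(E,1)/Ω_E = t`), `hxs` (the four
Néron-normalised plus modular-symbol values on the Teichmüller coset, engines S = Sage/eclib ≡ P = PARI, stepL `nms` third engine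
152/152), and for `BSDp` `hq hv` (`#Ш_an`). Facts: the nine (+ `hGS` at split pairs) [+ `hGZK`]. Grammar = p3's records verbatim
with the door swapped.

| pair | model | `N` | at 5 | `∏c` | `#Ш_an` | `L/Ω` | re-keyed record |
|---|---|---|---|---|---|---|---|
| `115320u1` | `[0, 1, 0, -196, -5371]` | `2³·3·5·31²` | non-split | 10 (`c₅ = 1`) | 1 | 10 | `PrintX11aHardLocusRecordsFive3` |
| `184960ck1` | `[0, 1, 0, -555, -5275]` | `2⁷·5·17²` | split | 10 (`c₅ = 5`) | 1 | 10 | `PrintX11aHardLocusRecordsFive4` |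

Beyond-print theorem: NO. Theorems only (no `def`, no named fact, no `sorry`, no instance/notation).

References: [Kato2004Asterisque] Thm. 12.4 (p. 221), §17.13 (pp. 279–280); [SteinWuthrich2013] Thm. 6.1; [Mazur1978] Cor. 4.1,
§6 Prop. 6.3 (1); [MazurTateTeitelbaum1986Invent] §I.10, §I.12–I.13; [GreenbergStevens1993] (`greenberg_stevens`); [Miller2011LMS]
Def. 1.1; [Cremona2006] Table 1; tree `Theorems/PrintX11aUpperNonSurjThreeEngineWithoutGZK.lean` (+ `…Corollary18OfMazur`), `Theorems/PrintX11aUpperNonSurjFiveOfNineFacts.lean` (the packaged door), `Theorems/PrintX11aMuCosetDoor.lean`,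
`Theorems/PrintX11aHardLocusRecords{Door,Cosets,Five5–7}.lean`, `Theorems/PrintX11aMuCosetRecords5/15/20.lean`,
`Theorems/ErratumRoadFiveNonSurjCornerTwinMuAnRhoBarInvariance.lean` (`NonSurjTwin.muAn_clause_iff_allowableRoot`, inlined here); cell doc `pub/bsd-print-x11a/TY3-CERTIFICATE-RECORDS.md` §7–§8, §16.
-/

set_option autoImplicit false

noncomputable section

open scoped Classical MatrixGroups ModularForm

open CongruenceSubgroup WeierstrassCurve Literature.NumberTheory.EllipticCurves
  Literature.NumberTheory.EllipticCurves.ModularForms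
  Literature.NumberTheory.EllipticCurves.Rank1Residual
  Literature.NumberTheory.EllipticCurves.Rank1Residual.Typed
  Literature.NumberTheory.EllipticCurves.Rank1Residual.X11RankOneCertificates
  Literature.NumberTheory.EllipticCurves.Wuthrich2014
  Literature.NumberTheory.EllipticCurves.SteinWuthrich2013
  Literature.NumberTheory.EllipticCurves.Greenberg1999
  Literature.NumberTheory.EllipticCurves.Kato2004
  Summit.BirchSwinnertonDyer.BirchSwinnertonDyer.Rank1Residual.IntModel
  Summit.BirchSwinnertonDyer.BirchSwinnertonDyer.Theorems
  Summit.BirchSwinnertonDyer.Rank1Residual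
  Summit.BirchSwinnertonDyer.Rank1Residual.Supersingular
  Summit.BirchSwinnertonDyer.Rank1Residual.X11b

namespace Summit.BirchSwinnertonDyer.Rank1Residual.X11a.TamagawaClosures

/-! ### `115320u1 @ 5` (`N = 115320 = 2³·3·5·31²`, image `5S4`, NON-split multiplicative at `5`, `∏ c_ℓ = 10` (`c₅ = 1`), `L(E,1)/Ω_E = 10`, `#Ш_an = 1`) -/

/-- **`115320u1 @ 5`: the UPPER half `ord₅ #Ш ≤ ord₅ #Ш_an`** (`Typed.MissingUpperBoundAt W 5`) FLAG-FREE: the NINE print-exact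
facts engine of lines finemu3/finemu5 (= the body of line-x11a-p3 g6's per-pair door
`ClassX11a.missingUpperBoundAt_of_not_surj_of_hardCert_of_nineFacts`, p626443, inlined to stay out of the route file's import cone):
`X11b.multDivisibilityAt_of_katoFacts_of_muAn_contra_of_mazur` (Kato 12.4, modularity `exists_isNewformOf`, Kato §17.13 V′/VI′/XI′
`_contra`, Mazur Cor. 4.1; tree theorem `nonempty_iwasawaH1Data_holds`) then `X11b.missingUpperBoundAt_of_multDivisibilityAt_of_analyticRank_eq_zero_noGZK`
(Stein–Wuthrich 6.1 ×2, modularity; no Greenberg–Stevens (non-split `p`: the split branch is vacuous, `not_split_of_ainvs` in the kernel)), fed AT THE PAIR with the μ-certificate `X11a.MuAnZeroAt W 5` built in the kernel from the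
DISPLAYED coset table of `PrintX11aHardLocusRecordsFive3.lean` (ty3 two-engine μ-witness, `RecordsLeafNonSurjMuPart1–2.lean` §7) through p3's `muAnZeroAt_of_cosetTable` / `muAn5_m…` (Mazur Cor. 4.1 only), read in the allowable-root currency
(`isMultPAdicLFunctionOf_one_iff`). DISPLAYED: `r_an = 0` (`hr`),
image bit `¬Surj` (`hnsj`, `5S4`), `L(E,1)/Ω_E = 10` (`ht`), the symbol values (`hxs`). KERNEL: `Δ ≠ 0`, minimality
(`HardLocusRecords.isGloballyMinimal_c115320u1`), `Mult`, `Irr` (`HardLocusRecords.card_c115320u1_11`), `¬Ram` from `Irr ∧ ¬Surj` (`HardLocusRecords.classX11a_of_ainvs`). Re-keying of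
`PrintX11aHardLocusRecordsFive3.lean`'s record (thirteen γ-keyed facts, counting flag R-48) to the flag-free nine; PER PAIR (E1); nothing booked by this file.
[cite: Kato2004Asterisque, Thm. 12.4 (p. 221) and §17.13 (pp. 279–280)] [cite: SteinWuthrich2013, Thm. 6.1 (p. 20)]
[cite: Mazur1978, Cor. 4.1] [cite: MazurTateTeitelbaum1986Invent, §I.10 and §I.12–I.13] [cite: Cremona2006, Table 1 (Cremona label 115320u1)] -/
theorem mub5_t115320u1
    (hJs : thm61_splitMultiplicative) (hJn : thm61_nonsplitMultiplicative)
    (h12 : Kato2004.thm12_4) (hnf : exists_isNewformOf)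
    (hns' : Kato2004.exists_multDivisibilityInputs_nonsplit_contra)
    (hsp' : Kato2004.exists_multDivisibilityInputs_split_contra)
    (hfine' : Kato2004.exists_multDivisibilityInputs_fine_contra) (hMz : mazur_not_dvd_maninConstant_of_odd)
    (W : WeierstrassCurve ℚ) (hW : W = ⟨0, 1, 0, -196, -5371⟩)
    (hr : W.analyticRank = 0) (hnsj : ∀ [Fact (Nat.Prime 5)], ¬ Surj W 5)
    (ht : W.entireLFunction 1 / (W.realPeriodRat : ℂ) = ((10 : ℚ) : ℂ))
    (hxs : ∀ {N : ℕ} [NeZero N] (f : CuspForm (Gamma0 N) 2), IsNewformOf W f →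
      ∀ (ϖ : ℚ), (ϖ : ℝ) * W.realPeriodRat = plusPeriod f → ∀ b ∈ ({1, 7, 18, 24} : Finset (ZMod 25)),
        ϖ * ratPlusSymbol f ((b.val : ℚ) / (5 : ℚ) ^ 2) = (if b = 1 then 5/2 else if b = 7 then (-1/2) else if b = 18 then (-1/2) else 5/2 : ℚ)) :
    MissingUpperBoundAt W 5 := by
  haveI : W.IsElliptic := by rw [hW]; exact X11b.isElliptic_of_discOf_ne_zero 0 1 0 (-196) (-5371) (by decide +kernel)
  haveI : W.IsGloballyMinimal := by rw [hW]; exact HardLocusRecords.isGloballyMinimal_c115320u1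
  haveI : Fact (Nat.Prime 5) := ⟨by norm_num⟩
  haveI : Fact (Nat.Prime 11) := ⟨by norm_num⟩
  have hI' : integralModelInt W = ⟨0, 1, 0, -196, -5371⟩ := by
    subst hW; exact integralModelInt_eq_of_map_eq _ (map_mk_int 0 1 0 (-196) (-5371))
  have hX : ClassX11a W 5 := HardLocusRecords.classX11a_of_ainvs 0 1 0 (-196) (-5371) hI' 5 11 6 (by decide) (by decide +kernel)
    (by decide +kernel) (by decide) (by decide +kernel) HardLocusRecords.card_c115320u1_11 (by decide +kernel) hr hnsj
  have hnonsplit : ¬ W.HasSplitMultiplicativeReductionAtPrime 5 :=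
    HardLocusRecords.not_split_of_ainvs 0 1 0 (-196) (-5371) hI' 5 (by decide +kernel) (by decide +kernel) HardLocusRecords.nodal_c115320u1
  have hunit : ‖((∑ b ∈ ({1, 7, 18, 24} : Finset (ZMod 25)), (if b = 1 then 5/2 else if b = 7 then (-1/2) else if b = 18 then (-1/2) else 5/2 : ℚ) : ℚ) : ℚ_[5])‖ = 1 := by
    rw [show (∑ b ∈ ({1, 7, 18, 24} : Finset (ZMod 25)), (if b = 1 then 5/2 else if b = 7 then (-1/2) else if b = 18 then (-1/2) else 5/2 : ℚ)) = ((4 : ℤ) : ℚ) / ((1 : ℕ) : ℚ)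
      from by decide +kernel]
    exact X11a.MuCoset.norm_intCast_div_natCast_eq_one (by decide) (by decide)
  have hμ : X11a.MuAnZeroAt W 5 := muAnZeroAt_of_cosetTable hMz (by decide) hX.mult hX.irr 10 ht
    (by exact_mod_cast Padic.norm_int_le_one (p := 5) (10 : ℤ)) 1 (0 : ZMod 5) (({1, 7, 18, 24} : Finset (ZMod 25))) HardLocusRecords.coset_five_sq_zero
    (fun b : ZMod 25 => (if b = 1 then 5/2 else if b = 7 then (-1/2) else if b = 18 then (-1/2) else 5/2 : ℚ)) hxs hunit
  refine X11b.missingUpperBoundAt_of_multDivisibilityAt_of_analyticRank_eq_zero_noGZK hJs hJn hnf W 5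
    (fun hsplit => absurd hsplit hnonsplit) (by decide) hX.mult hr ?_
  refine X11b.multDivisibilityAt_of_katoFacts_of_muAn_contra_of_mazur nonempty_iwasawaH1Data_holds h12 hnf hns' hsp'
    hfine' hMz W 5 (by decide) hX.mult hX.irr hnsj ?_
  -- the μ-certificate in the allowable-root currency (stepL's `NonSurjTwin.muAn_clause_iff_allowableRoot`, inlined)
  intro N _ f hf ϖ hϖ a L hsa hna hL
  obtain ⟨hns0, hs0⟩ := hμ f hf ϖ hϖ
  by_cases hsplit : W.HasSplitMultiplicativeReductionAtPrime 5
  · have ha : a = 1 := hsa hsplit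
    subst ha
    exact hs0 hsplit L ((isMultPAdicLFunctionOf_one_iff L).mp hL)
  · have ha : a = -1 := hna hsplit
    subst ha
    exact hns0 hsplit L hL

/-- **`BSD(E,5)` for `115320u1`, FLAG-FREE** (`#Ш_an = 1`, a `5`-adic unit displayed as `hq`/`hv`, so the lower half is free):
`mub5_t115320u1` + GZK (`hGZK`) through p3's `bsdp_of_upper_of_unit_of_analyticRank_eq_zero`. Facts: the nine + GZK;
displayed: `hW`, `hr`, `hnsj`, `ht`, `hxs`, `hq hv`. PER PAIR (E1 currency); nothing booked by this file.
[cite: Miller2011LMS, §1 and Def. 1.1] [cite: Kato2004Asterisque, §17.13 (pp. 279–280)] [cite: Cremona2006, Table 1 (Cremona label 115320u1)] -/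
theorem bsdp5_t115320u1
    (hJs : thm61_splitMultiplicative) (hJn : thm61_nonsplitMultiplicative)
    (h12 : Kato2004.thm12_4) (hnf : exists_isNewformOf)
    (hns' : Kato2004.exists_multDivisibilityInputs_nonsplit_contra)
    (hsp' : Kato2004.exists_multDivisibilityInputs_split_contra)
    (hfine' : Kato2004.exists_multDivisibilityInputs_fine_contra) (hMz : mazur_not_dvd_maninConstant_of_odd)
    (hGZK : rank_eq_analyticRank_of_analyticRank_le_one)
    (W : WeierstrassCurve ℚ) (hW : W = ⟨0, 1, 0, -196, -5371⟩)
    (hr : W.analyticRank = 0) (hnsj : ∀ [Fact (Nat.Prime 5)], ¬ Surj W 5)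
    (ht : W.entireLFunction 1 / (W.realPeriodRat : ℂ) = ((10 : ℚ) : ℂ))
    (hxs : ∀ {N : ℕ} [NeZero N] (f : CuspForm (Gamma0 N) 2), IsNewformOf W f →
      ∀ (ϖ : ℚ), (ϖ : ℝ) * W.realPeriodRat = plusPeriod f → ∀ b ∈ ({1, 7, 18, 24} : Finset (ZMod 25)),
        ϖ * ratPlusSymbol f ((b.val : ℚ) / (5 : ℚ) ^ 2) = (if b = 1 then 5/2 else if b = 7 then (-1/2) else if b = 18 then (-1/2) else 5/2 : ℚ))
    {q : ℚ} (hq : shaAn W = (q : ℂ)) (hv : padicValRat 5 q = 0) : BSDp W 5 := by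
  haveI : W.IsElliptic := by rw [hW]; exact X11b.isElliptic_of_discOf_ne_zero 0 1 0 (-196) (-5371) (by decide +kernel)
  haveI : Fact (Nat.Prime 5) := ⟨by norm_num⟩
  exact bsdp_of_upper_of_unit_of_analyticRank_eq_zero W 5 hGZK hr
    (mub5_t115320u1 hJs hJn h12 hnf hns' hsp' hfine' hMz W hW hr hnsj ht hxs) hq hv

/-! ### `184960ck1 @ 5` (`N = 184960 = 2⁷·5·17²`, image `5S4`, SPLIT multiplicative at `5`, `∏ c_ℓ = 10` (`c₅ = 5`), `L(E,1)/Ω_E = 10`, `#Ш_an = 1`) -/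

/-- **`184960ck1 @ 5`: the UPPER half `ord₅ #Ш ≤ ord₅ #Ш_an`** (`Typed.MissingUpperBoundAt W 5`) FLAG-FREE: the NINE print-exact
facts engine of lines finemu3/finemu5 (= the body of line-x11a-p3 g6's per-pair door
`ClassX11a.missingUpperBoundAt_of_not_surj_of_hardCert_of_nineFacts`, p626443, inlined to stay out of the route file's import cone):
`X11b.multDivisibilityAt_of_katoFacts_of_muAn_contra_of_mazur` (Kato 12.4, modularity `exists_isNewformOf`, Kato §17.13 V′/VI′/XI′
`_contra`, Mazur Cor. 4.1; tree theorem `nonempty_iwasawaH1Data_holds`) then `X11b.missingUpperBoundAt_of_multDivisibilityAt_of_analyticRank_eq_zero_noGZK`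
(Stein–Wuthrich 6.1 ×2, modularity; Greenberg–Stevens at the pair (`hGS`, split `p`)), fed AT THE PAIR with the μ-certificate `X11a.MuAnZeroAt W 5` built in the kernel from the
DISPLAYED coset table of `PrintX11aHardLocusRecordsFive4.lean` (ty3 two-engine μ-witness, `RecordsLeafNonSurjMuPart1–2.lean` §7) through p3's `muAnZeroAt_of_cosetTable` / `muAn5_m…` (Mazur Cor. 4.1 only), read in the allowable-root currency
(`isMultPAdicLFunctionOf_one_iff`). DISPLAYED: `r_an = 0` (`hr`),
image bit `¬Surj` (`hnsj`, `5S4`), `L(E,1)/Ω_E = 10` (`ht`), the symbol values (`hxs`). KERNEL: `Δ ≠ 0`, minimality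
(`HardLocusRecords.isGloballyMinimal_c184960ck1`), `Mult`, `Irr` (`HardLocusRecords.card_c184960ck1_7`), `¬Ram` from `Irr ∧ ¬Surj` (`HardLocusRecords.classX11a_of_ainvs`). Re-keying of
`PrintX11aHardLocusRecordsFive4.lean`'s record (thirteen γ-keyed facts, counting flag R-48) to the flag-free nine; PER PAIR (E1); nothing booked by this file.
[cite: Kato2004Asterisque, Thm. 12.4 (p. 221) and §17.13 (pp. 279–280)] [cite: SteinWuthrich2013, Thm. 6.1 (p. 20)]
[cite: Mazur1978, Cor. 4.1] [cite: MazurTateTeitelbaum1986Invent, §I.10 and §I.12–I.13] [cite: Cremona2006, Table 1 (Cremona label 184960ck1)] -/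
theorem mub5_t184960ck1
    (hJs : thm61_splitMultiplicative) (hJn : thm61_nonsplitMultiplicative)
    (h12 : Kato2004.thm12_4) (hnf : exists_isNewformOf)
    (hns' : Kato2004.exists_multDivisibilityInputs_nonsplit_contra)
    (hsp' : Kato2004.exists_multDivisibilityInputs_split_contra)
    (hfine' : Kato2004.exists_multDivisibilityInputs_fine_contra) (hMz : mazur_not_dvd_maninConstant_of_odd)
    (W : WeierstrassCurve ℚ) (hW : W = ⟨0, 1, 0, -555, -5275⟩)
    (hGS : ∀ [W.IsElliptic] [W.IsGloballyMinimal] [Fact (Nat.Prime 5)], greenberg_stevens (W := W) (p := 5))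
    (hr : W.analyticRank = 0) (hnsj : ∀ [Fact (Nat.Prime 5)], ¬ Surj W 5)
    (ht : W.entireLFunction 1 / (W.realPeriodRat : ℂ) = ((10 : ℚ) : ℂ))
    (hxs : ∀ {N : ℕ} [NeZero N] (f : CuspForm (Gamma0 N) 2), IsNewformOf W f →
      ∀ (ϖ : ℚ), (ϖ : ℝ) * W.realPeriodRat = plusPeriod f → ∀ b ∈ ({1, 7, 18, 24} : Finset (ZMod 25)),
        ϖ * ratPlusSymbol f ((b.val : ℚ) / (5 : ℚ) ^ 2) = (if b = 1 then 5/2 else if b = 7 then 2 else if b = 18 then 2 else 5/2 : ℚ)) :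
    MissingUpperBoundAt W 5 := by
  haveI : W.IsElliptic := by rw [hW]; exact X11b.isElliptic_of_discOf_ne_zero 0 1 0 (-555) (-5275) (by decide +kernel)
  haveI : W.IsGloballyMinimal := by rw [hW]; exact HardLocusRecords.isGloballyMinimal_c184960ck1
  haveI : Fact (Nat.Prime 5) := ⟨by norm_num⟩
  haveI : Fact (Nat.Prime 7) := ⟨by norm_num⟩
  have hI' : integralModelInt W = ⟨0, 1, 0, -555, -5275⟩ := by
    subst hW; exact integralModelInt_eq_of_map_eq _ (map_mk_int 0 1 0 (-555) (-5275))
  have hX : ClassX11a W 5 := HardLocusRecords.classX11a_of_ainvs 0 1 0 (-555) (-5275) hI' 5 7 3 (by decide) (by decide +kernel)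
    (by decide +kernel) (by decide) (by decide +kernel) HardLocusRecords.card_c184960ck1_7 (by decide +kernel) hr hnsj
  have hunit : ‖((∑ b ∈ ({1, 7, 18, 24} : Finset (ZMod 25)), (if b = 1 then 5/2 else if b = 7 then 2 else if b = 18 then 2 else 5/2 : ℚ) : ℚ) : ℚ_[5])‖ = 1 := by
    rw [show (∑ b ∈ ({1, 7, 18, 24} : Finset (ZMod 25)), (if b = 1 then 5/2 else if b = 7 then 2 else if b = 18 then 2 else 5/2 : ℚ)) = ((9 : ℤ) : ℚ) / ((1 : ℕ) : ℚ)
      from by decide +kernel]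
    exact X11a.MuCoset.norm_intCast_div_natCast_eq_one (by decide) (by decide)
  have hμ : X11a.MuAnZeroAt W 5 := muAnZeroAt_of_cosetTable hMz (by decide) hX.mult hX.irr 10 ht
    (by exact_mod_cast Padic.norm_int_le_one (p := 5) (10 : ℤ)) 1 (0 : ZMod 5) (({1, 7, 18, 24} : Finset (ZMod 25))) HardLocusRecords.coset_five_sq_zero
    (fun b : ZMod 25 => (if b = 1 then 5/2 else if b = 7 then 2 else if b = 18 then 2 else 5/2 : ℚ)) hxs hunit
  refine X11b.missingUpperBoundAt_of_multDivisibilityAt_of_analyticRank_eq_zero_noGZK hJs hJn hnf W 5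
    (fun _ => hGS) (by decide) hX.mult hr ?_
  refine X11b.multDivisibilityAt_of_katoFacts_of_muAn_contra_of_mazur nonempty_iwasawaH1Data_holds h12 hnf hns' hsp'
    hfine' hMz W 5 (by decide) hX.mult hX.irr hnsj ?_
  -- the μ-certificate in the allowable-root currency (stepL's `NonSurjTwin.muAn_clause_iff_allowableRoot`, inlined)
  intro N _ f hf ϖ hϖ a L hsa hna hL
  obtain ⟨hns0, hs0⟩ := hμ f hf ϖ hϖ
  by_cases hsplit : W.HasSplitMultiplicativeReductionAtPrime 5
  · have ha : a = 1 := hsa hsplit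
    subst ha
    exact hs0 hsplit L ((isMultPAdicLFunctionOf_one_iff L).mp hL)
  · have ha : a = -1 := hna hsplit
    subst ha
    exact hns0 hsplit L hL

/-- **`BSD(E,5)` for `184960ck1`, FLAG-FREE** (`#Ш_an = 1`, a `5`-adic unit displayed as `hq`/`hv`, so the lower half is free):
`mub5_t184960ck1` + GZK (`hGZK`) through p3's `bsdp_of_upper_of_unit_of_analyticRank_eq_zero`. Facts: the nine + GS at the pair + GZK;
displayed: `hW`, `hr`, `hnsj`, `ht`, `hxs`, `hq hv`. PER PAIR (E1 currency); nothing booked by this file.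
[cite: Miller2011LMS, §1 and Def. 1.1] [cite: Kato2004Asterisque, §17.13 (pp. 279–280)] [cite: Cremona2006, Table 1 (Cremona label 184960ck1)] -/
theorem bsdp5_t184960ck1
    (hJs : thm61_splitMultiplicative) (hJn : thm61_nonsplitMultiplicative)
    (h12 : Kato2004.thm12_4) (hnf : exists_isNewformOf)
    (hns' : Kato2004.exists_multDivisibilityInputs_nonsplit_contra)
    (hsp' : Kato2004.exists_multDivisibilityInputs_split_contra)
    (hfine' : Kato2004.exists_multDivisibilityInputs_fine_contra) (hMz : mazur_not_dvd_maninConstant_of_odd)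
    (hGZK : rank_eq_analyticRank_of_analyticRank_le_one)
    (W : WeierstrassCurve ℚ) (hW : W = ⟨0, 1, 0, -555, -5275⟩)
    (hGS : ∀ [W.IsElliptic] [W.IsGloballyMinimal] [Fact (Nat.Prime 5)], greenberg_stevens (W := W) (p := 5))
    (hr : W.analyticRank = 0) (hnsj : ∀ [Fact (Nat.Prime 5)], ¬ Surj W 5)
    (ht : W.entireLFunction 1 / (W.realPeriodRat : ℂ) = ((10 : ℚ) : ℂ))
    (hxs : ∀ {N : ℕ} [NeZero N] (f : CuspForm (Gamma0 N) 2), IsNewformOf W f →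
      ∀ (ϖ : ℚ), (ϖ : ℝ) * W.realPeriodRat = plusPeriod f → ∀ b ∈ ({1, 7, 18, 24} : Finset (ZMod 25)),
        ϖ * ratPlusSymbol f ((b.val : ℚ) / (5 : ℚ) ^ 2) = (if b = 1 then 5/2 else if b = 7 then 2 else if b = 18 then 2 else 5/2 : ℚ))
    {q : ℚ} (hq : shaAn W = (q : ℂ)) (hv : padicValRat 5 q = 0) : BSDp W 5 := by
  haveI : W.IsElliptic := by rw [hW]; exact X11b.isElliptic_of_discOf_ne_zero 0 1 0 (-555) (-5275) (by decide +kernel)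
  haveI : Fact (Nat.Prime 5) := ⟨by norm_num⟩
  exact bsdp_of_upper_of_unit_of_analyticRank_eq_zero W 5 hGZK hr
    (mub5_t184960ck1 hJs hJn h12 hnf hns' hsp' hfine' hMz W hW hGS hr hnsj ht hxs) hq hv

end Summit.BirchSwinnertonDyer.Rank1Residual.X11a.TamagawaClosures

end
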